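import Literature.NumberTheory.Rogawski1990.ArchLimitFormulaNoncompactWallConstUnique  -- ★ p841778 (R1-d″)(a): uniqueness of the (J-nc) constant; brings ★ p840202 the letter
import Literature.NumberTheory.Automorphic.ArchLocalRelabelTransport           -- ★ p840351: the relabelling iso `e_σ`, `relabel_circleDiagonal`, the torus-integral transport
import Literature.NumberTheory.Automorphic.OrbitalIntegralCentralTransport     -- ★ `integral_descConj_quotientMeasure_eq_of_mulEquiv` (singular orbital integrals along a group iso)
import Literature.NumberTheory.Automorphic.ArchRankOneLimitFormulaPartial      -- ★ `tendsto_neg_nhdsWithin_ne_zero` (`𝓝[≠] 0` is symmetric under `ψ ↦ −ψ`)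
import Mathlib.Analysis.Calculus.Deriv.Shift                                   -- `deriv_comp_neg`
import HarnessLib

/-!
# (R1-d)(b1) The (J-nc) constant is TRANSPORTED along the wall-preserving relabelling `(0 2)` (ROAD-Sd R1, «COHERENCE ∕ TRANSPORT», within-class half)
(Rogawski (1990) §8.2 pp. 119, 122–124; Varadarajan (1989) §6.4 Thm 22; Bröcker–tom Dieck IV (3.2))

Topic `NumberTheory/Rogawski1990`; namespace `Literature.NumberTheory.Rogawski1990`.  THEOREMS ONLY (no definition, no instance, no notation, no named fact, no `sorry`).
Cell `hodgecm-mathlib`, crux H413 (`stmt-HodgeConjecture-24833`); LEAD F0P3a-plan (g9) WORD T8-85 (1) ∕ T8-93 («cut (b1) alone now; (b2) cross-wall = the VALUE letter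
(J-val), booked as the named hypothesis `hXwall`»); F0P3-p03 (g9); census line F0∕P3a 06:17:39Z.  Count-neutral floor-1 plumbing under books rows #111 (S-d) ∕ #88 (ST-∞);
HC_CM is proved only modulo the printed citations until rung 0 closes.

THE POINT.  The (J-nc) letter ★ `ArchLimitFormulaNoncompactWall L α w` produces, per datum `(ν, z₁, ν_H)` on `G_w(α) = U(σ_w diag α)(ℂ)`, ONE constant `c` for the standard one-angle
curve `ψ ↦ diag(z₀₀e^{iψ}, z₀₁, z₀₂e^{−iψ})` at the `{0,2}`-wall; ★ p841778 `archLimitFormulaNoncompactWall_const_unique` says the CLAUSE pins `c`.  In the stable sum of R1 the six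
relabelled points `z∘ρ` fall into wall classes; WITHIN the class of the `{0,2}`-wall the two relabellings differ by the swap `σ = (0 2)`, and the relabelling iso
`e_σ : G_w(β∘σ) ≃ₜ* G_w(β)` (★ p840351, `g ↦ M(σ) g M(σ)⁻¹`) carries the standard curve of `G_w(β∘σ)` to the REVERSED standard curve `ψ ↦ z_{−ψ}` of `G_w(β)`
(`diag z ↦ diag (z∘σ⁻¹)`, `![1,0,−1]∘σ⁻¹ = −![1,0,−1]`).  Since `2 sin ψ · F(z_{−ψ}) = −g(−ψ)` has derivative `g′(−ψ)` and the punctured filter `𝓝[≠] 0` is symmetric, and since the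
singular orbital integral `∫ descConj … d(ν∕ν_H)` is carried by `e_σ` (★ `integral_descConj_quotientMeasure_eq_of_mulEquiv`), THE CLAUSE for `(β∘σ; ν′, z₁, ν_H′, c)` implies THE CLAUSE
for `(β; e_σ_* ν′, z₁∘σ⁻¹, (e_σ|_Z)_* ν_H′, c)` with the SAME `c` — pure transport of structure, no harmonic analysis.  With ★ p841778 on `G_w(β)` the consumer (p07 (g7)'s R1 assembly)
concludes `c_v(ρ) = c_v(ρ∘(0 2))` for coherent (= transported) data.  ACROSS the two noncompact wall classes nothing of the kind holds structurally ((b2) = (J-val), hypothesis `hXwall`).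

* `stdExponent_swap02_symm_mul`, `swap02_curve_comp_symm` — the swap reverses the standard curve.
* `archLimitFormulaNoncompactWall_const_eq_of_transport_swap02` — (CM `L`) the two pinned constants agree (the transport + ★ p841778).
* `archLimitFormulaNoncompactWall_clause_transport_swap02` — the transport of the letter's conclusion clause along `e_{(0 2)}` (statement: the clause of ★ `ArchLimitFormulaNoncompactWall`
  VERBATIM on both sides, source weights `β ∘ Equiv.swap 0 2`, target weights `β`; the target data as variables `ν`, `νH` with defining equations `hν`, `hνH`).

## References
* [Rogawski1990] J. D. Rogawski, *Automorphic Representations of Unitary Groups in Three Variables*, Ann. of Math. Stud. 123 (1990), §8.2 pp. 119, 122–124 (the relabelled classes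
  `γ, γ₁, γ₂`; the HC constant).
* [Varadarajan1989] V. S. Varadarajan, *An Introduction to Harmonic Analysis on Semisimple Lie Groups* (1989), §6.4 Thm 22.
* [BrockerTomDieck1985] T. Bröcker, T. tom Dieck, *Representations of Compact Lie Groups* (1985), IV (3.2) (Weyl group of `U(n)` = relabellings).
* [DeitmarEchterhoff2014] A. Deitmar, S. Echterhoff, *Principles of Harmonic Analysis*, 2nd ed. (2014), Thm. 1.5.3.
-/

set_option autoImplicit false

noncomputable section

open MeasureTheory Measure Filter Topology NumberField NumberField.InfinitePlace Matrix Equiv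
open Literature.MeasureTheory.Group Literature.NumberTheory.Automorphic Literature.NumberTheory.Automorphic.UnitaryGroup
open Literature.LinearAlgebra.Matrix
open scoped Matrix MatrixGroups Matrix.Norms.Operator

namespace Literature.NumberTheory.Rogawski1990

section Transport

variable (L : Type) [Field L] (β : Fin 3 → L) (w : {w : InfinitePlace L // IsComplex w})

/-- The exponent vector of the standard curve is REVERSED by the swap: `![1,0,−1] ((0 2)⁻¹ i) · ψ = ![1,0,−1] i · (−ψ)`. [cite: BrockerTomDieck1985, IV (3.2)] -/
theorem stdExponent_swap02_symm_mul (i : Fin 3) (ψ : ℝ) :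
    (![(1 : ℝ), 0, -1] ((Equiv.swap (0 : Fin 3) 2).symm i)) * ψ = ![(1 : ℝ), 0, -1] i * (-ψ) := by
  rw [Equiv.symm_swap]
  fin_cases i
  · simp [Equiv.swap_apply_left]
  · have h : (Equiv.swap (0 : Fin 3) 2) 1 = 1 := Equiv.swap_apply_of_ne_of_ne (by decide) (by decide)
    simp [h]
  · simp [Equiv.swap_apply_right]

/-- The relabelled standard curve of `G_w(β∘σ)` at `z₀∘σ`, read back on the labels of `G_w(β)`, is the standard curve of `G_w(β)` at `z₀` run BACKWARDS:
`(fun i => (z₀ (σ i) · e^{i v_i ψ})) ∘ σ⁻¹ = fun i => z₀ i · e^{i v_i (−ψ)}`. [cite: BrockerTomDieck1985, IV (3.2)] [cite: Rogawski1990, §8.2 p. 122] -/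
theorem swap02_curve_comp_symm (z₀ : Fin 3 → Circle) (ψ : ℝ) :
    (fun i => (fun j => z₀ ((Equiv.swap (0 : Fin 3) 2) j) * Circle.exp (![(1 : ℝ), 0, -1] j * ψ)) ((Equiv.swap (0 : Fin 3) 2).symm i)) =
      fun i => z₀ i * Circle.exp (![(1 : ℝ), 0, -1] i * (-ψ)) := by
  funext i
  simp only [Equiv.apply_symm_apply, stdExponent_swap02_symm_mul]

/-- **(R1-d)(b1) THE (J-nc) CLAUSE IS TRANSPORTED ALONG THE WALL-PRESERVING RELABELLING `σ = (0 2)`.**  If `c` satisfies the conclusion clause of ★ `ArchLimitFormulaNoncompactWall` on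
`G_w(β∘σ)` for the datum `(ν′, z₁, ν_H′)`, then the SAME `c` satisfies it on `G_w(β)` for the transported datum `(ν = e_σ_* ν′, z₁∘σ⁻¹, ν_H = (e_σ|_Z)_* ν_H′)` (`e_σ` = ★ p840351's
relabelling iso; `h02t`, `h01t` are the trivial wall facts of `z₁∘σ⁻¹`, any proofs).  Proof: test `Θ′ = Θ(M(σ)·M(σ)⁻¹)` at `z₀∘σ`; the source torus integral is the target one at `−ψ`
(★ `integral_comp_conj_circleDiagonal_comp_perm_eq_integral_map_relabel`), `2 sin ψ·F(−ψ) = −g(−ψ)`, `deriv (−g(−·)) ψ = g′(−ψ)`, `𝓝[≠] 0` symmetric; the singular side by ★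
`integral_descConj_quotientMeasure_eq_of_mulEquiv`. [cite: Rogawski1990, §8.2 pp. 119, 122–124] [cite: Varadarajan1989, §6.4 Thm 22] [cite: DeitmarEchterhoff2014, Thm. 1.5.3] -/
theorem archLimitFormulaNoncompactWall_clause_transport_swap02
    [LocallyCompactSpace (archLocal L 3 (Matrix.diagonal (β ∘ (Equiv.swap (0 : Fin 3) 2))) w)] [SecondCountableTopology (archLocal L 3 (Matrix.diagonal (β ∘ (Equiv.swap (0 : Fin 3) 2))) w)] [MeasurableSpace (archLocal L 3 (Matrix.diagonal (β ∘ (Equiv.swap (0 : Fin 3) 2))) w)] [BorelSpace (archLocal L 3 (Matrix.diagonal (β ∘ (Equiv.swap (0 : Fin 3) 2))) w)]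
    [LocallyCompactSpace (archLocal L 3 (Matrix.diagonal β) w)] [SecondCountableTopology (archLocal L 3 (Matrix.diagonal β) w)] [MeasurableSpace (archLocal L 3 (Matrix.diagonal β) w)] [BorelSpace (archLocal L 3 (Matrix.diagonal β) w)]
    (ν' : Measure (archLocal L 3 (Matrix.diagonal (β ∘ (Equiv.swap (0 : Fin 3) 2))) w)) [ν'.IsHaarMeasure] [ν'.IsMulRightInvariant]
    (ν : Measure (archLocal L 3 (Matrix.diagonal β) w)) [ν.IsHaarMeasure] [ν.IsMulRightInvariant]
    (hν : ν = ν'.map (ContinuousMulEquiv.restrictSubgroup (GLn.conjEquiv (Matrix.GeneralLinearGroup.mkOfDetNeZero _ (det_monomial_one_ne_zero 3 (Equiv.swap (0 : Fin 3) 2))))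
        (archLocal L 3 (Matrix.diagonal (β ∘ (Equiv.swap (0 : Fin 3) 2))) w) (archLocal L 3 (Matrix.diagonal β) w) (mem_archLocal_comp_perm_iff_conj_mem L 3 β w (Equiv.swap (0 : Fin 3) 2))))
    (z₁ : Fin 3 → Circle) (h02 : z₁ 0 = z₁ 2) (h01 : z₁ 0 ≠ z₁ 1)
    (h02t : (fun i => z₁ ((Equiv.swap (0 : Fin 3) 2).symm i)) 0 = (fun i => z₁ ((Equiv.swap (0 : Fin 3) 2).symm i)) 2)
    (h01t : (fun i => z₁ ((Equiv.swap (0 : Fin 3) 2).symm i)) 0 ≠ (fun i => z₁ ((Equiv.swap (0 : Fin 3) 2).symm i)) 1)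
    (νH' : Measure (Subgroup.centralizer ({(⟨circleDiagonal 3 z₁, circleDiagonal_mem_archLocal_diagonal L 3 (β ∘ (Equiv.swap (0 : Fin 3) 2)) w _⟩ : archLocal L 3 (Matrix.diagonal (β ∘ (Equiv.swap (0 : Fin 3) 2))) w)} : Set (archLocal L 3 (Matrix.diagonal (β ∘ (Equiv.swap (0 : Fin 3) 2))) w)))) [νH'.IsHaarMeasure] [νH'.IsInvInvariant]
    (νH : Measure (Subgroup.centralizer ({(⟨circleDiagonal 3 (fun i => z₁ ((Equiv.swap (0 : Fin 3) 2).symm i)), circleDiagonal_mem_archLocal_diagonal L 3 β w _⟩ : archLocal L 3 (Matrix.diagonal β) w)} : Set (archLocal L 3 (Matrix.diagonal β) w)))) [νH.IsHaarMeasure] [νH.IsInvInvariant]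
    (hνH : νH = νH'.map (subgroupCongrHomeomorph (ContinuousMulEquiv.restrictSubgroup (GLn.conjEquiv (Matrix.GeneralLinearGroup.mkOfDetNeZero _ (det_monomial_one_ne_zero 3 (Equiv.swap (0 : Fin 3) 2))))
        (archLocal L 3 (Matrix.diagonal (β ∘ (Equiv.swap (0 : Fin 3) 2))) w) (archLocal L 3 (Matrix.diagonal β) w) (mem_archLocal_comp_perm_iff_conj_mem L 3 β w (Equiv.swap (0 : Fin 3) 2))).toMulEquiv
      (Subgroup.centralizer ({(⟨circleDiagonal 3 z₁, circleDiagonal_mem_archLocal_diagonal L 3 (β ∘ (Equiv.swap (0 : Fin 3) 2)) w _⟩ : archLocal L 3 (Matrix.diagonal (β ∘ (Equiv.swap (0 : Fin 3) 2))) w)} : Set (archLocal L 3 (Matrix.diagonal (β ∘ (Equiv.swap (0 : Fin 3) 2))) w))) (Subgroup.centralizer ({(⟨circleDiagonal 3 (fun i => z₁ ((Equiv.swap (0 : Fin 3) 2).symm i)), circleDiagonal_mem_archLocal_diagonal L 3 β w _⟩ : archLocal L 3 (Matrix.diagonal β) w)} : Set (archLocal L 3 (Matrix.diagonal β) w)))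
      (forall_apply_mem_centralizer_singleton_iff_of_eq (ContinuousMulEquiv.restrictSubgroup (GLn.conjEquiv (Matrix.GeneralLinearGroup.mkOfDetNeZero _ (det_monomial_one_ne_zero 3 (Equiv.swap (0 : Fin 3) 2))))
        (archLocal L 3 (Matrix.diagonal (β ∘ (Equiv.swap (0 : Fin 3) 2))) w) (archLocal L 3 (Matrix.diagonal β) w) (mem_archLocal_comp_perm_iff_conj_mem L 3 β w (Equiv.swap (0 : Fin 3) 2))).toMulEquiv (relabel_circleDiagonal L 3 β w (Equiv.swap (0 : Fin 3) 2) z₁))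
      (ContinuousMulEquiv.restrictSubgroup (GLn.conjEquiv (Matrix.GeneralLinearGroup.mkOfDetNeZero _ (det_monomial_one_ne_zero 3 (Equiv.swap (0 : Fin 3) 2))))
        (archLocal L 3 (Matrix.diagonal (β ∘ (Equiv.swap (0 : Fin 3) 2))) w) (archLocal L 3 (Matrix.diagonal β) w) (mem_archLocal_comp_perm_iff_conj_mem L 3 β w (Equiv.swap (0 : Fin 3) 2))).continuous (ContinuousMulEquiv.restrictSubgroup (GLn.conjEquiv (Matrix.GeneralLinearGroup.mkOfDetNeZero _ (det_monomial_one_ne_zero 3 (Equiv.swap (0 : Fin 3) 2))))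
        (archLocal L 3 (Matrix.diagonal (β ∘ (Equiv.swap (0 : Fin 3) 2))) w) (archLocal L 3 (Matrix.diagonal β) w) (mem_archLocal_comp_perm_iff_conj_mem L 3 β w (Equiv.swap (0 : Fin 3) 2))).symm.continuous))
    [MeasurableSpace (archLocal L 3 (Matrix.diagonal (β ∘ (Equiv.swap (0 : Fin 3) 2))) w ⧸ Subgroup.centralizer ({(⟨circleDiagonal 3 z₁, circleDiagonal_mem_archLocal_diagonal L 3 (β ∘ (Equiv.swap (0 : Fin 3) 2)) w _⟩ : archLocal L 3 (Matrix.diagonal (β ∘ (Equiv.swap (0 : Fin 3) 2))) w)} : Set (archLocal L 3 (Matrix.diagonal (β ∘ (Equiv.swap (0 : Fin 3) 2))) w)))] [BorelSpace (archLocal L 3 (Matrix.diagonal (β ∘ (Equiv.swap (0 : Fin 3) 2))) w ⧸ Subgroup.centralizer ({(⟨circleDiagonal 3 z₁, circleDiagonal_mem_archLocal_diagonal L 3 (β ∘ (Equiv.swap (0 : Fin 3) 2)) w _⟩ : archLocal L 3 (Matrix.diagonal (β ∘ (Equiv.swap (0 : Fin 3) 2))) w)} : Set (archLocal L 3 (Matrix.diagonal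 (β ∘ (Equiv.swap (0 : Fin 3) 2))) w)))]
    [MeasurableSpace (archLocal L 3 (Matrix.diagonal β) w ⧸ Subgroup.centralizer ({(⟨circleDiagonal 3 (fun i => z₁ ((Equiv.swap (0 : Fin 3) 2).symm i)), circleDiagonal_mem_archLocal_diagonal L 3 β w _⟩ : archLocal L 3 (Matrix.diagonal β) w)} : Set (archLocal L 3 (Matrix.diagonal β) w)))] [BorelSpace (archLocal L 3 (Matrix.diagonal β) w ⧸ Subgroup.centralizer ({(⟨circleDiagonal 3 (fun i => z₁ ((Equiv.swap (0 : Fin 3) 2).symm i)), circleDiagonal_mem_archLocal_diagonal L 3 β w _⟩ : archLocal L 3 (Matrix.diagonal β) w)} : Set (archLocal L 3 (Matrix.diagonal β) w)))]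
    (c : ℂ)
    (hc : ∀ (Θ : Matrix (Fin 3) (Fin 3) ℂ → ℂ), ContDiff ℝ (⊤ : ℕ∞) Θ →
        HasCompactSupport (fun k : archLocal L 3 (Matrix.diagonal (β ∘ (Equiv.swap (0 : Fin 3) 2))) w => Θ ((k : GL (Fin 3) ℂ) : Matrix (Fin 3) (Fin 3) ℂ)) →
        ∀ (z₀ : Fin 3 → Circle) (h02' : z₀ 0 = z₀ 2) (h01' : z₀ 0 ≠ z₀ 1),
          Tendsto (fun ψ : ℝ => deriv (fun ψ : ℝ => (2 * Real.sin ψ : ℂ) *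
              ∫ g, Θ (((g * (⟨circleDiagonal 3 (fun i => z₀ i * Circle.exp (![(1 : ℝ), 0, -1] i * ψ)), circleDiagonal_mem_archLocal_diagonal L 3 (β ∘ (Equiv.swap (0 : Fin 3) 2)) w _⟩ : archLocal L 3 (Matrix.diagonal (β ∘ (Equiv.swap (0 : Fin 3) 2))) w) * g⁻¹ : archLocal L 3 (Matrix.diagonal (β ∘ (Equiv.swap (0 : Fin 3) 2))) w) : GL (Fin 3) ℂ) : Matrix (Fin 3) (Fin 3) ℂ) ∂ν') ψ)
            (𝓝[≠] 0)
            (𝓝 (c * ∫ y, descConj (⟨circleDiagonal 3 z₀, circleDiagonal_mem_archLocal_diagonal L 3 (β ∘ (Equiv.swap (0 : Fin 3) 2)) w _⟩ : archLocal L 3 (Matrix.diagonal (β ∘ (Equiv.swap (0 : Fin 3) 2))) w)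
              (Subgroup.centralizer ({(⟨circleDiagonal 3 z₁, circleDiagonal_mem_archLocal_diagonal L 3 (β ∘ (Equiv.swap (0 : Fin 3) 2)) w _⟩ : archLocal L 3 (Matrix.diagonal (β ∘ (Equiv.swap (0 : Fin 3) 2))) w)} : Set (archLocal L 3 (Matrix.diagonal (β ∘ (Equiv.swap (0 : Fin 3) 2))) w)))
              (forall_mem_centralizer_circleDiagonal_comm_of_wall L (β ∘ (Equiv.swap (0 : Fin 3) 2)) w h02 h01 h02' h01')
              (fun k : archLocal L 3 (Matrix.diagonal (β ∘ (Equiv.swap (0 : Fin 3) 2))) w => Θ ((k : GL (Fin 3) ℂ) : Matrix (Fin 3) (Fin 3) ℂ)) y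
              ∂(quotientMeasure _ νH' (isClosed_coe_centralizer_singleton _) ν')))) :
    ∀ (Θ : Matrix (Fin 3) (Fin 3) ℂ → ℂ), ContDiff ℝ (⊤ : ℕ∞) Θ →
        HasCompactSupport (fun k : archLocal L 3 (Matrix.diagonal β) w => Θ ((k : GL (Fin 3) ℂ) : Matrix (Fin 3) (Fin 3) ℂ)) →
        ∀ (z₀ : Fin 3 → Circle) (h02' : z₀ 0 = z₀ 2) (h01' : z₀ 0 ≠ z₀ 1),
          Tendsto (fun ψ : ℝ => deriv (fun ψ : ℝ => (2 * Real.sin ψ : ℂ) *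
              ∫ g, Θ (((g * (⟨circleDiagonal 3 (fun i => z₀ i * Circle.exp (![(1 : ℝ), 0, -1] i * ψ)), circleDiagonal_mem_archLocal_diagonal L 3 β w _⟩ : archLocal L 3 (Matrix.diagonal β) w) * g⁻¹ : archLocal L 3 (Matrix.diagonal β) w) : GL (Fin 3) ℂ) : Matrix (Fin 3) (Fin 3) ℂ) ∂ν) ψ)
            (𝓝[≠] 0)
            (𝓝 (c * ∫ y, descConj (⟨circleDiagonal 3 z₀, circleDiagonal_mem_archLocal_diagonal L 3 β w _⟩ : archLocal L 3 (Matrix.diagonal β) w)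
              (Subgroup.centralizer ({(⟨circleDiagonal 3 (fun i => z₁ ((Equiv.swap (0 : Fin 3) 2).symm i)), circleDiagonal_mem_archLocal_diagonal L 3 β w _⟩ : archLocal L 3 (Matrix.diagonal β) w)} : Set (archLocal L 3 (Matrix.diagonal β) w)))
              (forall_mem_centralizer_circleDiagonal_comm_of_wall L β w h02t h01t h02' h01')
              (fun k : archLocal L 3 (Matrix.diagonal β) w => Θ ((k : GL (Fin 3) ℂ) : Matrix (Fin 3) (Fin 3) ℂ)) y
              ∂(quotientMeasure _ νH (isClosed_coe_centralizer_singleton _) ν))) := by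
  intro Θ hΘ hΘc z₀ h02' h01'
  -- the relabelling iso and the transported test function / wall point on the source
  set e := (ContinuousMulEquiv.restrictSubgroup (GLn.conjEquiv (Matrix.GeneralLinearGroup.mkOfDetNeZero _ (det_monomial_one_ne_zero 3 (Equiv.swap (0 : Fin 3) 2))))
        (archLocal L 3 (Matrix.diagonal (β ∘ (Equiv.swap (0 : Fin 3) 2))) w) (archLocal L 3 (Matrix.diagonal β) w) (mem_archLocal_comp_perm_iff_conj_mem L 3 β w (Equiv.swap (0 : Fin 3) 2))) with he_def
  have hΘ' := contDiff_comp_monomial_conj (N := 3) (σ := (Equiv.swap (0 : Fin 3) 2)) Θ hΘ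
  have hΘ'c := hasCompactSupport_comp_relabel L 3 β w (Equiv.swap (0 : Fin 3) 2) Θ hΘc
  have h02s : (fun j => z₀ ((Equiv.swap (0 : Fin 3) 2) j)) 0 = (fun j => z₀ ((Equiv.swap (0 : Fin 3) 2) j)) 2 := by
    simp only [Equiv.swap_apply_left, Equiv.swap_apply_right]; exact h02'.symm
  have h01s : (fun j => z₀ ((Equiv.swap (0 : Fin 3) 2) j)) 0 ≠ (fun j => z₀ ((Equiv.swap (0 : Fin 3) 2) j)) 1 := by
    have h1 : (Equiv.swap (0 : Fin 3) 2) 1 = 1 := Equiv.swap_apply_of_ne_of_ne (by decide) (by decide)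
    simp only [Equiv.swap_apply_left, h1]
    exact fun h => h01' (h02'.trans h)
  have key := hc _ hΘ' hΘ'c (fun j => z₀ ((Equiv.swap (0 : Fin 3) 2) j)) h02s h01s
  -- (1) the source torus integral at `ψ` is the target torus integral at `−ψ`
  have hνs : ν.map e.symm = ν' := by
    have hms : Measurable (e.symm : archLocal L 3 (Matrix.diagonal β) w → archLocal L 3 (Matrix.diagonal (β ∘ (Equiv.swap (0 : Fin 3) 2))) w) := e.symm.continuous.measurable
    have hm : Measurable (e : archLocal L 3 (Matrix.diagonal (β ∘ (Equiv.swap (0 : Fin 3) 2))) w → archLocal L 3 (Matrix.diagonal β) w) := e.continuous.measurable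
    rw [hν, Measure.map_map hms hm]
    have hid : (e.symm : archLocal L 3 (Matrix.diagonal β) w → archLocal L 3 (Matrix.diagonal (β ∘ (Equiv.swap (0 : Fin 3) 2))) w) ∘ (e : archLocal L 3 (Matrix.diagonal (β ∘ (Equiv.swap (0 : Fin 3) 2))) w → archLocal L 3 (Matrix.diagonal β) w) = id := funext fun x => e.symm_apply_apply x
    rw [hid, Measure.map_id]
  have hF : ∀ ψ : ℝ,
      ∫ g', (fun A : Matrix (Fin 3) (Fin 3) ℂ => Θ ((monomial (Equiv.swap (0 : Fin 3) 2) fun _ : Fin 3 => (1 : ℂ)) * A *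
          (((Matrix.GeneralLinearGroup.mkOfDetNeZero _ (det_monomial_one_ne_zero 3 (Equiv.swap (0 : Fin 3) 2)))⁻¹ : GL (Fin 3) ℂ) : Matrix (Fin 3) (Fin 3) ℂ)))
        (((g' * (⟨circleDiagonal 3 (fun i => (fun j => z₀ ((Equiv.swap (0 : Fin 3) 2) j)) i * Circle.exp (![(1 : ℝ), 0, -1] i * ψ)), circleDiagonal_mem_archLocal_diagonal L 3 (β ∘ (Equiv.swap (0 : Fin 3) 2)) w _⟩ : archLocal L 3 (Matrix.diagonal (β ∘ (Equiv.swap (0 : Fin 3) 2))) w) * g'⁻¹ : archLocal L 3 (Matrix.diagonal (β ∘ (Equiv.swap (0 : Fin 3) 2))) w) : GL (Fin 3) ℂ) :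
          Matrix (Fin 3) (Fin 3) ℂ) ∂ν' =
      ∫ g, Θ (((g * (⟨circleDiagonal 3 (fun i => z₀ i * Circle.exp (![(1 : ℝ), 0, -1] i * (-ψ))), circleDiagonal_mem_archLocal_diagonal L 3 β w _⟩ : archLocal L 3 (Matrix.diagonal β) w) * g⁻¹ : archLocal L 3 (Matrix.diagonal β) w) : GL (Fin 3) ℂ) : Matrix (Fin 3) (Fin 3) ℂ) ∂ν := by
    intro ψ
    have h := integral_comp_conj_circleDiagonal_comp_perm_eq_integral_map_relabel L 3 β w (Equiv.swap (0 : Fin 3) 2) ν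
      (fun k : archLocal L 3 (Matrix.diagonal β) w => Θ ((k : GL (Fin 3) ℂ) : Matrix (Fin 3) (Fin 3) ℂ)) (fun j => z₀ ((Equiv.swap (0 : Fin 3) 2) j) * Circle.exp (![(1 : ℝ), 0, -1] j * ψ))
    rw [hνs] at h
    simp only [apply_coe_relabel] at h
    rw [← h]
    congr 1
    funext g
    congr 4
    apply Subtype.ext
    simp only [swap02_curve_comp_symm]
  -- (2) so the source `g`-function is `ψ ↦ −g(−ψ)` for the target `g`
  have hg : (fun ψ : ℝ => (2 * Real.sin ψ : ℂ) *
      ∫ g', (fun A : Matrix (Fin 3) (Fin 3) ℂ => Θ ((monomial (Equiv.swap (0 : Fin 3) 2) fun _ : Fin 3 => (1 : ℂ)) * A *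
          (((Matrix.GeneralLinearGroup.mkOfDetNeZero _ (det_monomial_one_ne_zero 3 (Equiv.swap (0 : Fin 3) 2)))⁻¹ : GL (Fin 3) ℂ) : Matrix (Fin 3) (Fin 3) ℂ)))
        (((g' * (⟨circleDiagonal 3 (fun i => (fun j => z₀ ((Equiv.swap (0 : Fin 3) 2) j)) i * Circle.exp (![(1 : ℝ), 0, -1] i * ψ)), circleDiagonal_mem_archLocal_diagonal L 3 (β ∘ (Equiv.swap (0 : Fin 3) 2)) w _⟩ : archLocal L 3 (Matrix.diagonal (β ∘ (Equiv.swap (0 : Fin 3) 2))) w) * g'⁻¹ : archLocal L 3 (Matrix.diagonal (β ∘ (Equiv.swap (0 : Fin 3) 2))) w) : GL (Fin 3) ℂ) :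
          Matrix (Fin 3) (Fin 3) ℂ) ∂ν') =
      fun ψ : ℝ => -((2 * Real.sin (-ψ) : ℂ) * ∫ g, Θ (((g * (⟨circleDiagonal 3 (fun i => z₀ i * Circle.exp (![(1 : ℝ), 0, -1] i * (-ψ))), circleDiagonal_mem_archLocal_diagonal L 3 β w _⟩ : archLocal L 3 (Matrix.diagonal β) w) * g⁻¹ : archLocal L 3 (Matrix.diagonal β) w) : GL (Fin 3) ℂ) : Matrix (Fin 3) (Fin 3) ℂ) ∂ν) := by
    funext ψ
    rw [hF ψ]
    simp only [Real.sin_neg]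
    push_cast
    ring
  rw [hg] at key
  have hder : (fun ψ : ℝ => deriv (fun ψ : ℝ => -((2 * Real.sin (-ψ) : ℂ) * ∫ g, Θ (((g * (⟨circleDiagonal 3 (fun i => z₀ i * Circle.exp (![(1 : ℝ), 0, -1] i * (-ψ))), circleDiagonal_mem_archLocal_diagonal L 3 β w _⟩ : archLocal L 3 (Matrix.diagonal β) w) * g⁻¹ : archLocal L 3 (Matrix.diagonal β) w) : GL (Fin 3) ℂ) : Matrix (Fin 3) (Fin 3) ℂ) ∂ν)) ψ) =
      fun ψ : ℝ => deriv (fun ψ : ℝ => (2 * Real.sin ψ : ℂ) * ∫ g, Θ (((g * (⟨circleDiagonal 3 (fun i => z₀ i * Circle.exp (![(1 : ℝ), 0, -1] i * ψ)), circleDiagonal_mem_archLocal_diagonal L 3 β w _⟩ : archLocal L 3 (Matrix.diagonal β) w) * g⁻¹ : archLocal L 3 (Matrix.diagonal β) w) : GL (Fin 3) ℂ) : Matrix (Fin 3) (Fin 3) ℂ) ∂ν) (-ψ) := by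
    funext ψ
    rw [deriv.fun_neg]
    have h := deriv_comp_neg (f := fun ψ : ℝ => (2 * Real.sin ψ : ℂ) * ∫ g, Θ (((g * (⟨circleDiagonal 3 (fun i => z₀ i * Circle.exp (![(1 : ℝ), 0, -1] i * ψ)), circleDiagonal_mem_archLocal_diagonal L 3 β w _⟩ : archLocal L 3 (Matrix.diagonal β) w) * g⁻¹ : archLocal L 3 (Matrix.diagonal β) w) : GL (Fin 3) ℂ) : Matrix (Fin 3) (Fin 3) ℂ) ∂ν) (x := ψ)
    rw [h, neg_neg]
  rw [hder] at key
  -- (3) the symmetric punctured filter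
  have key2 := key.comp tendsto_neg_nhdsWithin_ne_zero  -- ★ `ArchRankOneLimitFormulaPartial`: `𝓝[≠] 0` is symmetric
  simp only [Function.comp_def, neg_neg] at key2
  -- (4) the singular orbital integral is carried by `e`
  haveI : IsClosed ((Subgroup.centralizer ({(⟨circleDiagonal 3 z₁, circleDiagonal_mem_archLocal_diagonal L 3 (β ∘ (Equiv.swap (0 : Fin 3) 2)) w _⟩ : archLocal L 3 (Matrix.diagonal (β ∘ (Equiv.swap (0 : Fin 3) 2))) w)} : Set (archLocal L 3 (Matrix.diagonal (β ∘ (Equiv.swap (0 : Fin 3) 2))) w)) : Subgroup (archLocal L 3 (Matrix.diagonal (β ∘ (Equiv.swap (0 : Fin 3) 2))) w)) : Set (archLocal L 3 (Matrix.diagonal (β ∘ (Equiv.swap (0 : Fin 3) 2))) w)) := isClosed_coe_centralizer_singleton _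
  haveI : IsClosed ((Subgroup.centralizer ({(⟨circleDiagonal 3 (fun i => z₁ ((Equiv.swap (0 : Fin 3) 2).symm i)), circleDiagonal_mem_archLocal_diagonal L 3 β w _⟩ : archLocal L 3 (Matrix.diagonal β) w)} : Set (archLocal L 3 (Matrix.diagonal β) w)) : Subgroup (archLocal L 3 (Matrix.diagonal β) w)) : Set (archLocal L 3 (Matrix.diagonal β) w)) := isClosed_coe_centralizer_singleton _
  have hγ₀ : e.toMulEquiv (⟨circleDiagonal 3 (fun j => z₀ ((Equiv.swap (0 : Fin 3) 2) j)), circleDiagonal_mem_archLocal_diagonal L 3 (β ∘ (Equiv.swap (0 : Fin 3) 2)) w _⟩ : archLocal L 3 (Matrix.diagonal (β ∘ (Equiv.swap (0 : Fin 3) 2))) w) = (⟨circleDiagonal 3 z₀, circleDiagonal_mem_archLocal_diagonal L 3 β w _⟩ : archLocal L 3 (Matrix.diagonal β) w) := by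
    show e _ = _
    rw [he_def, relabel_circleDiagonal]
    apply Subtype.ext
    simp only [Equiv.apply_symm_apply]
  have hI := integral_descConj_quotientMeasure_eq_of_mulEquiv e.toMulEquiv e.continuous e.symm.continuous
    (Subgroup.centralizer ({(⟨circleDiagonal 3 z₁, circleDiagonal_mem_archLocal_diagonal L 3 (β ∘ (Equiv.swap (0 : Fin 3) 2)) w _⟩ : archLocal L 3 (Matrix.diagonal (β ∘ (Equiv.swap (0 : Fin 3) 2))) w)} : Set (archLocal L 3 (Matrix.diagonal (β ∘ (Equiv.swap (0 : Fin 3) 2))) w))) (Subgroup.centralizer ({(⟨circleDiagonal 3 (fun i => z₁ ((Equiv.swap (0 : Fin 3) 2).symm i)), circleDiagonal_mem_archLocal_diagonal L 3 β w _⟩ : archLocal L 3 (Matrix.diagonal β) w)} : Set (archLocal L 3 (Matrix.diagonal β) w)))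
    (forall_apply_mem_centralizer_singleton_iff_of_eq e.toMulEquiv (relabel_circleDiagonal L 3 β w (Equiv.swap (0 : Fin 3) 2) z₁))
    νH' νH ν' ν hνH hν hγ₀
    (forall_mem_centralizer_circleDiagonal_comm_of_wall L (β ∘ (Equiv.swap (0 : Fin 3) 2)) w h02 h01 h02s h01s)
    (forall_mem_centralizer_circleDiagonal_comm_of_wall L β w h02t h01t h02' h01')
    (fun k : archLocal L 3 (Matrix.diagonal β) w => Θ ((k : GL (Fin 3) ℂ) : Matrix (Fin 3) (Fin 3) ℂ))
  have hcomp : ((fun k : archLocal L 3 (Matrix.diagonal β) w => Θ ((k : GL (Fin 3) ℂ) : Matrix (Fin 3) (Fin 3) ℂ)) ∘ e.toMulEquiv) =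
      fun k : archLocal L 3 (Matrix.diagonal (β ∘ (Equiv.swap (0 : Fin 3) 2))) w => (fun A : Matrix (Fin 3) (Fin 3) ℂ => Θ ((monomial (Equiv.swap (0 : Fin 3) 2) fun _ : Fin 3 => (1 : ℂ)) * A *
          (((Matrix.GeneralLinearGroup.mkOfDetNeZero _ (det_monomial_one_ne_zero 3 (Equiv.swap (0 : Fin 3) 2)))⁻¹ : GL (Fin 3) ℂ) : Matrix (Fin 3) (Fin 3) ℂ)))
        ((k : GL (Fin 3) ℂ) : Matrix (Fin 3) (Fin 3) ℂ) := by
    funext k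
    exact apply_coe_relabel L 3 β w (Equiv.swap (0 : Fin 3) 2) Θ k
  rw [hcomp] at hI
  rw [hI]
  exact key2

end Transport

/-! ## The equality of the two pinned constants (CM field: ★ p841778 uniqueness on the target) -/

section CM

variable (L : Type) [Field L] [NumberField L] [IsCMField L] (β : Fin 3 → L) (w : {w : InfinitePlace L // IsComplex w})

/-- **(R1-d)(b1) WITHIN-CLASS COHERENCE**: for a CM field, if `c₁` satisfies the (J-nc) clause on `G_w(β)` for the datum `(ν, z₁∘σ⁻¹, ν_H)` and `c₂` satisfies it on `G_w(β∘σ)` for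
`(ν′, z₁, ν_H′)`, the two data being TRANSPORTS of each other along `e_σ` (`hν`, `hνH`), then `c₁ = c₂` (transport above + ★ p841778
`archLimitFormulaNoncompactWall_const_unique`). [cite: Rogawski1990, §8.2 pp. 119, 122–124] [cite: Varadarajan1989, §6.4 Thm 22] -/
theorem archLimitFormulaNoncompactWall_const_eq_of_transport_swap02
    [LocallyCompactSpace (archLocal L 3 (Matrix.diagonal (β ∘ (Equiv.swap (0 : Fin 3) 2))) w)] [SecondCountableTopology (archLocal L 3 (Matrix.diagonal (β ∘ (Equiv.swap (0 : Fin 3) 2))) w)] [MeasurableSpace (archLocal L 3 (Matrix.diagonal (β ∘ (Equiv.swap (0 : Fin 3) 2))) w)] [BorelSpace (archLocal L 3 (Matrix.diagonal (β ∘ (Equiv.swap (0 : Fin 3) 2))) w)]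
    [LocallyCompactSpace (archLocal L 3 (Matrix.diagonal β) w)] [SecondCountableTopology (archLocal L 3 (Matrix.diagonal β) w)] [MeasurableSpace (archLocal L 3 (Matrix.diagonal β) w)] [BorelSpace (archLocal L 3 (Matrix.diagonal β) w)]
    (hβ : ∀ i, β i ≠ 0) (hreal : ∀ i, (w.1.embedding (β i)).im = 0)
    (ν' : Measure (archLocal L 3 (Matrix.diagonal (β ∘ (Equiv.swap (0 : Fin 3) 2))) w)) [ν'.IsHaarMeasure] [ν'.IsMulRightInvariant]
    (ν : Measure (archLocal L 3 (Matrix.diagonal β) w)) [ν.IsHaarMeasure] [ν.IsMulRightInvariant]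
    (hν : ν = ν'.map (ContinuousMulEquiv.restrictSubgroup (GLn.conjEquiv (Matrix.GeneralLinearGroup.mkOfDetNeZero _ (det_monomial_one_ne_zero 3 (Equiv.swap (0 : Fin 3) 2))))
        (archLocal L 3 (Matrix.diagonal (β ∘ (Equiv.swap (0 : Fin 3) 2))) w) (archLocal L 3 (Matrix.diagonal β) w) (mem_archLocal_comp_perm_iff_conj_mem L 3 β w (Equiv.swap (0 : Fin 3) 2))))
    (z₁ : Fin 3 → Circle) (h02 : z₁ 0 = z₁ 2) (h01 : z₁ 0 ≠ z₁ 1)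
    (h02t : (fun i => z₁ ((Equiv.swap (0 : Fin 3) 2).symm i)) 0 = (fun i => z₁ ((Equiv.swap (0 : Fin 3) 2).symm i)) 2)
    (h01t : (fun i => z₁ ((Equiv.swap (0 : Fin 3) 2).symm i)) 0 ≠ (fun i => z₁ ((Equiv.swap (0 : Fin 3) 2).symm i)) 1)
    (νH' : Measure (Subgroup.centralizer ({(⟨circleDiagonal 3 z₁, circleDiagonal_mem_archLocal_diagonal L 3 (β ∘ (Equiv.swap (0 : Fin 3) 2)) w _⟩ : archLocal L 3 (Matrix.diagonal (β ∘ (Equiv.swap (0 : Fin 3) 2))) w)} : Set (archLocal L 3 (Matrix.diagonal (β ∘ (Equiv.swap (0 : Fin 3) 2))) w)))) [νH'.IsHaarMeasure] [νH'.IsInvInvariant]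
    (νH : Measure (Subgroup.centralizer ({(⟨circleDiagonal 3 (fun i => z₁ ((Equiv.swap (0 : Fin 3) 2).symm i)), circleDiagonal_mem_archLocal_diagonal L 3 β w _⟩ : archLocal L 3 (Matrix.diagonal β) w)} : Set (archLocal L 3 (Matrix.diagonal β) w)))) [νH.IsHaarMeasure] [νH.IsInvInvariant]
    (hνH : νH = νH'.map (subgroupCongrHomeomorph (ContinuousMulEquiv.restrictSubgroup (GLn.conjEquiv (Matrix.GeneralLinearGroup.mkOfDetNeZero _ (det_monomial_one_ne_zero 3 (Equiv.swap (0 : Fin 3) 2))))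
        (archLocal L 3 (Matrix.diagonal (β ∘ (Equiv.swap (0 : Fin 3) 2))) w) (archLocal L 3 (Matrix.diagonal β) w) (mem_archLocal_comp_perm_iff_conj_mem L 3 β w (Equiv.swap (0 : Fin 3) 2))).toMulEquiv
      (Subgroup.centralizer ({(⟨circleDiagonal 3 z₁, circleDiagonal_mem_archLocal_diagonal L 3 (β ∘ (Equiv.swap (0 : Fin 3) 2)) w _⟩ : archLocal L 3 (Matrix.diagonal (β ∘ (Equiv.swap (0 : Fin 3) 2))) w)} : Set (archLocal L 3 (Matrix.diagonal (β ∘ (Equiv.swap (0 : Fin 3) 2))) w))) (Subgroup.centralizer ({(⟨circleDiagonal 3 (fun i => z₁ ((Equiv.swap (0 : Fin 3) 2).symm i)), circleDiagonal_mem_archLocal_diagonal L 3 β w _⟩ : archLocal L 3 (Matrix.diagonal β) w)} : Set (archLocal L 3 (Matrix.diagonal β) w)))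
      (forall_apply_mem_centralizer_singleton_iff_of_eq (ContinuousMulEquiv.restrictSubgroup (GLn.conjEquiv (Matrix.GeneralLinearGroup.mkOfDetNeZero _ (det_monomial_one_ne_zero 3 (Equiv.swap (0 : Fin 3) 2))))
        (archLocal L 3 (Matrix.diagonal (β ∘ (Equiv.swap (0 : Fin 3) 2))) w) (archLocal L 3 (Matrix.diagonal β) w) (mem_archLocal_comp_perm_iff_conj_mem L 3 β w (Equiv.swap (0 : Fin 3) 2))).toMulEquiv (relabel_circleDiagonal L 3 β w (Equiv.swap (0 : Fin 3) 2) z₁))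
      (ContinuousMulEquiv.restrictSubgroup (GLn.conjEquiv (Matrix.GeneralLinearGroup.mkOfDetNeZero _ (det_monomial_one_ne_zero 3 (Equiv.swap (0 : Fin 3) 2))))
        (archLocal L 3 (Matrix.diagonal (β ∘ (Equiv.swap (0 : Fin 3) 2))) w) (archLocal L 3 (Matrix.diagonal β) w) (mem_archLocal_comp_perm_iff_conj_mem L 3 β w (Equiv.swap (0 : Fin 3) 2))).continuous (ContinuousMulEquiv.restrictSubgroup (GLn.conjEquiv (Matrix.GeneralLinearGroup.mkOfDetNeZero _ (det_monomial_one_ne_zero 3 (Equiv.swap (0 : Fin 3) 2))))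
        (archLocal L 3 (Matrix.diagonal (β ∘ (Equiv.swap (0 : Fin 3) 2))) w) (archLocal L 3 (Matrix.diagonal β) w) (mem_archLocal_comp_perm_iff_conj_mem L 3 β w (Equiv.swap (0 : Fin 3) 2))).symm.continuous))
    [MeasurableSpace (archLocal L 3 (Matrix.diagonal (β ∘ (Equiv.swap (0 : Fin 3) 2))) w ⧸ Subgroup.centralizer ({(⟨circleDiagonal 3 z₁, circleDiagonal_mem_archLocal_diagonal L 3 (β ∘ (Equiv.swap (0 : Fin 3) 2)) w _⟩ : archLocal L 3 (Matrix.diagonal (β ∘ (Equiv.swap (0 : Fin 3) 2))) w)} : Set (archLocal L 3 (Matrix.diagonal (β ∘ (Equiv.swap (0 : Fin 3) 2))) w)))] [BorelSpace (archLocal L 3 (Matrix.diagonal (β ∘ (Equiv.swap (0 : Fin 3) 2))) w ⧸ Subgroup.centralizer ({(⟨circleDiagonal 3 z₁, circleDiagonal_mem_archLocal_diagonal L 3 (β ∘ (Equiv.swap (0 : Fin 3) 2)) w _⟩ : archLocal L 3 (Matrix.diagonal (β ∘ (Equiv.swap (0 : Fin 3) 2))) w)} : Set (archLocal L 3 (Matrix.diagonal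 (β ∘ (Equiv.swap (0 : Fin 3) 2))) w)))]
    [MeasurableSpace (archLocal L 3 (Matrix.diagonal β) w ⧸ Subgroup.centralizer ({(⟨circleDiagonal 3 (fun i => z₁ ((Equiv.swap (0 : Fin 3) 2).symm i)), circleDiagonal_mem_archLocal_diagonal L 3 β w _⟩ : archLocal L 3 (Matrix.diagonal β) w)} : Set (archLocal L 3 (Matrix.diagonal β) w)))] [BorelSpace (archLocal L 3 (Matrix.diagonal β) w ⧸ Subgroup.centralizer ({(⟨circleDiagonal 3 (fun i => z₁ ((Equiv.swap (0 : Fin 3) 2).symm i)), circleDiagonal_mem_archLocal_diagonal L 3 β w _⟩ : archLocal L 3 (Matrix.diagonal β) w)} : Set (archLocal L 3 (Matrix.diagonal β) w)))]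
    {c₁ c₂ : ℂ}
    (h₁ : ∀ (Θ : Matrix (Fin 3) (Fin 3) ℂ → ℂ), ContDiff ℝ (⊤ : ℕ∞) Θ →
        HasCompactSupport (fun k : archLocal L 3 (Matrix.diagonal β) w => Θ ((k : GL (Fin 3) ℂ) : Matrix (Fin 3) (Fin 3) ℂ)) →
        ∀ (z₀ : Fin 3 → Circle) (h02' : z₀ 0 = z₀ 2) (h01' : z₀ 0 ≠ z₀ 1),
          Tendsto (fun ψ : ℝ => deriv (fun ψ : ℝ => (2 * Real.sin ψ : ℂ) *
              ∫ g, Θ (((g * (⟨circleDiagonal 3 (fun i => z₀ i * Circle.exp (![(1 : ℝ), 0, -1] i * ψ)), circleDiagonal_mem_archLocal_diagonal L 3 β w _⟩ : archLocal L 3 (Matrix.diagonal β) w) * g⁻¹ : archLocal L 3 (Matrix.diagonal β) w) : GL (Fin 3) ℂ) : Matrix (Fin 3) (Fin 3) ℂ) ∂ν) ψ)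
            (𝓝[≠] 0)
            (𝓝 (c₁ * ∫ y, descConj (⟨circleDiagonal 3 z₀, circleDiagonal_mem_archLocal_diagonal L 3 β w _⟩ : archLocal L 3 (Matrix.diagonal β) w)
              (Subgroup.centralizer ({(⟨circleDiagonal 3 (fun i => z₁ ((Equiv.swap (0 : Fin 3) 2).symm i)), circleDiagonal_mem_archLocal_diagonal L 3 β w _⟩ : archLocal L 3 (Matrix.diagonal β) w)} : Set (archLocal L 3 (Matrix.diagonal β) w)))
              (forall_mem_centralizer_circleDiagonal_comm_of_wall L β w h02t h01t h02' h01')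
              (fun k : archLocal L 3 (Matrix.diagonal β) w => Θ ((k : GL (Fin 3) ℂ) : Matrix (Fin 3) (Fin 3) ℂ)) y
              ∂(quotientMeasure _ νH (isClosed_coe_centralizer_singleton _) ν))))
    (h₂ : ∀ (Θ : Matrix (Fin 3) (Fin 3) ℂ → ℂ), ContDiff ℝ (⊤ : ℕ∞) Θ →
        HasCompactSupport (fun k : archLocal L 3 (Matrix.diagonal (β ∘ (Equiv.swap (0 : Fin 3) 2))) w => Θ ((k : GL (Fin 3) ℂ) : Matrix (Fin 3) (Fin 3) ℂ)) →
        ∀ (z₀ : Fin 3 → Circle) (h02' : z₀ 0 = z₀ 2) (h01' : z₀ 0 ≠ z₀ 1),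
          Tendsto (fun ψ : ℝ => deriv (fun ψ : ℝ => (2 * Real.sin ψ : ℂ) *
              ∫ g, Θ (((g * (⟨circleDiagonal 3 (fun i => z₀ i * Circle.exp (![(1 : ℝ), 0, -1] i * ψ)), circleDiagonal_mem_archLocal_diagonal L 3 (β ∘ (Equiv.swap (0 : Fin 3) 2)) w _⟩ : archLocal L 3 (Matrix.diagonal (β ∘ (Equiv.swap (0 : Fin 3) 2))) w) * g⁻¹ : archLocal L 3 (Matrix.diagonal (β ∘ (Equiv.swap (0 : Fin 3) 2))) w) : GL (Fin 3) ℂ) : Matrix (Fin 3) (Fin 3) ℂ) ∂ν') ψ)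
            (𝓝[≠] 0)
            (𝓝 (c₂ * ∫ y, descConj (⟨circleDiagonal 3 z₀, circleDiagonal_mem_archLocal_diagonal L 3 (β ∘ (Equiv.swap (0 : Fin 3) 2)) w _⟩ : archLocal L 3 (Matrix.diagonal (β ∘ (Equiv.swap (0 : Fin 3) 2))) w)
              (Subgroup.centralizer ({(⟨circleDiagonal 3 z₁, circleDiagonal_mem_archLocal_diagonal L 3 (β ∘ (Equiv.swap (0 : Fin 3) 2)) w _⟩ : archLocal L 3 (Matrix.diagonal (β ∘ (Equiv.swap (0 : Fin 3) 2))) w)} : Set (archLocal L 3 (Matrix.diagonal (β ∘ (Equiv.swap (0 : Fin 3) 2))) w)))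
              (forall_mem_centralizer_circleDiagonal_comm_of_wall L (β ∘ (Equiv.swap (0 : Fin 3) 2)) w h02 h01 h02' h01')
              (fun k : archLocal L 3 (Matrix.diagonal (β ∘ (Equiv.swap (0 : Fin 3) 2))) w => Θ ((k : GL (Fin 3) ℂ) : Matrix (Fin 3) (Fin 3) ℂ)) y
              ∂(quotientMeasure _ νH' (isClosed_coe_centralizer_singleton _) ν')))) :
    c₁ = c₂ :=
  archLimitFormulaNoncompactWall_const_unique L β w hβ hreal ν h02t h01t νH h₁
    (archLimitFormulaNoncompactWall_clause_transport_swap02 L β w ν' ν hν z₁ h02 h01 h02t h01t νH' νH hνH c₂ h₂)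

end CM

end Literature.NumberTheory.Rogawski1990

end
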